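import Literature.Computability.QuantumComplexity.OracleWalk
import Literature.Computability.QuantumComplexity.ADHMachine
import Literature.Computability.Complexity.ListFoldBricks
import Literature.Computability.Complexity.FoldCatBricks
import HarnessLib

/-!
# The relativized path-pair walk as an `FP` string function: one round per gate, oracle gates included

Machine half (part 1) of the proof that `accGap F A p ∈ GapP^A` (`BQPRelSubsetAWPPRel.lean`,
Fortnow–Rogers 1999, Thm. 3.1 relativized: `BQP^A ⊆ AWPP^A`), continuing `OracleWalk.lean` (the
guessed walk `ADH.gRun`, its queries `ADH.gQrys`, the consistency check `ADH.gConsE`) and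
`ADHMachine.lean` (the oracle-free walk record `rec6`, its round `roundF` and all its parsing
bricks, which are reused verbatim). The walk record is extended, behind the five fields
`d E co w ph` of `rec6`, by seven more:

  `⟨d, ⟨E, ⟨co, ⟨w, ⟨ph, ⟨vb, ⟨an, ⟨ok, ⟨hh, ⟨cd, ⟨fl, out⟩⟩⟩⟩⟩⟩⟩⟩⟩⟩⟩`

— validity bit `vb`, the unread ANSWER bits `an` (one per gate, supplied by the oracle machine),
the consistency bit `ok`, the Hadamard counter `hh = 1^h`, a countdown `cd`, a written-flag `fl`
and an output register `out` — and one round `roundW` handles, besides `H, S, T, CNOT` (as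
`ADH.roundF`, reading now TWO coins per gate: the choice bit and the guessed answer bit), the
ORACLE gate `1 ⟨bin k, ⟨1^{k+1}, ⟨bin i₀, …, ⟨bin i_k, ε⟩⟩⟩⟩` (`QGate.encode`): it gathers the label
bits on the wires `i₀ … i_k` (a list fold, `Brick.foldFn`), so that the query `queryOf e w` is
their first `k` bits, XORs the guessed answer bit into the answer wire `i_k`, compares the guess
with the supplied answer bit (`ok`), and — in the round in which the countdown runs out — writes
the query into `out`. The round is specified against the record `recOf d E co m` of a machine
state `m : MS N` (`roundW_rec`: one round is `mStep`), keeps the first field and has constant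
growth, so `passW = roundW^{|d|}` is in `FP` (`iterate_mem_FP_of_growth`) and walks the whole gate
list (`iterate_roundW`: `mRun`); the projections of `mRun` are the spec functions of
`OracleWalk.lean` (`mRun_s`, `mRun_an`, `mRun_ok`, `mRun_hh`, `mRun_cd`, `mRun_fl`, `mRun_out`).
The assembly of the query generator and of the two relations is `AccGapMachine.lean`.

## References

* L. Fortnow, J. Rogers, *Complexity limitations on quantum computation*, JCSS 59 (1999),
  Lemma 3.2, Thm. 3.1, §3 ("Theorem 3.1 relativizes").
* L. M. Adleman, J. DeMarrais, M.-D. A. Huang, *Quantum computability*, SIAM J. Comput. 26 (1997),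
  §6 Lemma 6.10 (the path-pair machine).
* S. Arora, B. Barak, *Computational Complexity: A Modern Approach*, CUP 2009, §1.3, §1.4.1
  (composition, clocked loops), §3.4 (oracle machines).
-/

noncomputable section

namespace Literature.Computability.QuantumComplexity

namespace ADH

open _root_.Computability Polynomial Complexity Complexity.Brick Complexity.Plumb Cryptography

attribute [-simp] Brick.nthF_zero Brick.sndPow_zero

/-! ### The machine state and its step -/

/-- **The machine state** behind the walk record (everything but the kept description, the gates
ahead and the coin stream): core state `s` (label, phase, validity), unread answers `an`,
consistency bit `ok`, Hadamard count `hh`, countdown `cd`, written-flag `fl`, output `out`.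
[folklore] -/
structure MS (N : ℕ) where
  /-- label, phase modulo `8`, validity -/
  s : TState N
  /-- unread answer bits -/
  an : List Bool
  /-- consistency of the guesses read so far -/
  ok : Bool
  /-- number of Hadamard gates passed -/
  hh : ℕ
  /-- countdown to the round whose query is output -/
  cd : List Bool
  /-- has the output been written -/
  fl : Bool
  /-- the output register -/
  out : List Bool

variable {N : ℕ}

/-- **One step of the machine** on gate `g` with choice bit `c` and guessed answer bit `a`: the
core steps by `gStep`; one answer bit is consumed and compared with the guess
(`a = [g oracle] ∧ answer`); the Hadamard counter, the countdown, and the output (written with the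
query `gQry g` of the current label in the round in which the countdown is empty and nothing was
written before). [folklore] -/
def mStep (g : QGate cliffordT N) (c a : Bool) (m : MS N) : MS N where
  s := gStep g c a m.s
  an := m.an.tail
  ok := m.ok && (a == (isOr g && headBit m.an))
  hh := m.hh + (if QGateIsH g then 1 else 0)
  cd := m.cd.tail
  fl := m.fl || decide (m.cd = [])
  out := if m.cd = [] ∧ m.fl = false then gQry g m.s.1 else m.out

/-- **The machine walk** along a gate list, two coins per gate. [folklore] -/
def mRun : List (QGate cliffordT N) → List Bool → MS N → MS N
  | [], _, m => m
  | g :: gs, co, m => mRun gs (co.drop 2) (mStep g (headBit co) (headBit co.tail) m)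

/-- The core of the machine walk is the guessed walk. [folklore] -/
theorem mRun_s (gs : List (QGate cliffordT N)) : ∀ (co : List Bool) (m : MS N), (mRun gs co m).s = gRun gs co m.s := by
  induction gs with
  | nil => intro co m; rfl
  | cons g gs ih => intro co m; exact ih _ _

/-- The machine walk consumes one answer bit per gate. [folklore] -/
theorem mRun_an (gs : List (QGate cliffordT N)) : ∀ (co : List Bool) (m : MS N), (mRun gs co m).an = m.an.drop gs.length := by
  induction gs with
  | nil => intro co m; rfl
  | cons g gs ih => intro co m; rw [mRun, ih]; simp [mStep, List.drop_tail]

/-- The consistency bit accumulates `gConsE`. [folklore] -/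
theorem mRun_ok (gs : List (QGate cliffordT N)) : ∀ (co : List Bool) (m : MS N),
    (mRun gs co m).ok = (m.ok && gConsE gs co m.an m.s) := by
  induction gs with
  | nil => intro co m; simp [mRun, gConsE]
  | cons g gs ih => intro co m; rw [mRun, ih]; simp [mStep, gConsE, Bool.and_assoc]

/-- The Hadamard counter counts `hCount`. [folklore] -/
theorem mRun_hh (gs : List (QGate cliffordT N)) : ∀ (co : List Bool) (m : MS N), (mRun gs co m).hh = m.hh + hCount gs := by
  induction gs with
  | nil => intro co m; simp [mRun]
  | cons g gs ih => intro co m; rw [mRun, ih, hCount_cons]; simp [mStep]; ring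

/-- The countdown loses one symbol per gate. [folklore] -/
theorem mRun_cd (gs : List (QGate cliffordT N)) : ∀ (co : List Bool) (m : MS N), (mRun gs co m).cd = m.cd.drop gs.length := by
  induction gs with
  | nil => intro co m; rfl
  | cons g gs ih => intro co m; rw [mRun, ih]; simp [mStep, List.drop_tail]

/-- Once written, the output is kept. [folklore] -/
theorem mRun_out_of_fl (gs : List (QGate cliffordT N)) : ∀ (co : List Bool) (m : MS N), m.fl = true →
    (mRun gs co m).out = m.out ∧ (mRun gs co m).fl = true := by
  induction gs with
  | nil => intro co m h; exact ⟨rfl, h⟩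
  | cons g gs ih =>
    intro co m h
    rw [mRun]
    have h' := ih (co.drop 2) (mStep g (headBit co) (headBit co.tail) m) (by simp [mStep, h])
    rw [h'.1]
    exact ⟨by simp [mStep, h], h'.2⟩

/-- **The written-flag** is raised iff the countdown runs out during the walk. [folklore] -/
theorem mRun_fl (gs : List (QGate cliffordT N)) : ∀ (co : List Bool) (m : MS N),
    (mRun gs co m).fl = (m.fl || decide (m.cd.length < gs.length)) := by
  induction gs with
  | nil => intro co m; simp [mRun]
  | cons g gs ih =>
    intro co m
    rw [mRun, ih]
    cases hcd : m.cd with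
    | nil => simp [mStep, hcd]
    | cons b cd => simp [mStep, hcd]

/-- **The output of the machine walk** started unwritten: the query, along the guessed walk, of the
gate whose index is the length of the countdown (if the walk is that long), else unchanged.
[folklore] -/
theorem mRun_out (gs : List (QGate cliffordT N)) : ∀ (co : List Bool) (m : MS N), m.fl = false →
    (mRun gs co m).out = if h : m.cd.length < gs.length then (gQrys gs co m.s)[m.cd.length]'(by simpa using h) else m.out := by
  induction gs with
  | nil => intro co m _; simp [mRun]
  | cons g gs ih =>
    intro co m hfl
    rw [mRun]
    cases hcd : m.cd with
    | nil =>
      have hw : (mStep g (headBit co) (headBit co.tail) m).fl = true := by simp [mStep, hcd]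
      rw [(mRun_out_of_fl gs (co.drop 2) _ hw).1]
      simp [mStep, hcd, hfl, gQrys]
    | cons b cd =>
      have hw : (mStep g (headBit co) (headBit co.tail) m).fl = false := by simp [mStep, hcd, hfl]
      rw [ih (co.drop 2) _ hw]
      simp only [mStep, hcd, List.tail_cons, List.length_cons, gQrys, List.getElem_cons_succ]
      by_cases h : cd.length < gs.length
      · rw [dif_pos h, dif_pos (by omega)]
      · rw [dif_neg h, dif_neg (by omega)]
        simp [hfl]

/-! ### The walk record -/

/-- The tail of the record behind the phase field: `⟨[vb], ⟨an, ⟨[ok], ⟨1^hh, ⟨cd, ⟨[fl], out⟩⟩⟩⟩⟩⟩`.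
[folklore] -/
def tailOf (m : MS N) : List Bool :=
  boolPair [m.s.2.2] (boolPair m.an (boolPair [m.ok] (boolPair (ones m.hh) (boolPair m.cd (boolPair [m.fl] m.out)))))

/-- **The record of a machine state**: `rec6 d E co (label bits) 1^φ (tailOf m)`. [folklore] -/
def recOf (d E co : List Bool) (m : MS N) : List Bool :=
  rec6 d E co (List.ofFn m.s.1) (ones m.s.2.1) (tailOf m)

/-- Field `vb` (validity bit). [folklore] -/
abbrev vbF : List Bool → List Bool := nthF 5
/-- Field `an` (unread answers). [folklore] -/
abbrev anF : List Bool → List Bool := nthF 6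
/-- Field `ok` (consistency bit). [folklore] -/
abbrev okF : List Bool → List Bool := nthF 7
/-- Field `hh` (Hadamard counter). [folklore] -/
abbrev hhF : List Bool → List Bool := nthF 8
/-- Field `cd` (countdown). [folklore] -/
abbrev cdF : List Bool → List Bool := nthF 9
/-- Field `fl` (written-flag). [folklore] -/
abbrev flF : List Bool → List Bool := nthF 10
/-- Field `out` (output register). [folklore] -/
abbrev outF : List Bool → List Bool := sndPow 10

/-- Assembling a record from twelve field functions. [folklore] -/
def mkW (a b c d e f g h i j k l : List Bool → List Bool) : List Bool → List Bool :=
  mk6 a b c d e (pr f (pr g (pr h (pr i (pr j (pr k l))))))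

/-- `mkW` of `FP` functions is in `FP`. [folklore] -/
theorem mkW_mem_FP {a b c d e f g h i j k l : List Bool → List Bool} (ha : a ∈ FP) (hb : b ∈ FP) (hc : c ∈ FP)
    (hd : d ∈ FP) (he : e ∈ FP) (hf : f ∈ FP) (hg : g ∈ FP) (hh : h ∈ FP) (hi : i ∈ FP) (hj : j ∈ FP)
    (hk : k ∈ FP) (hl : l ∈ FP) : mkW a b c d e f g h i j k l ∈ FP :=
  mk6_mem_FP ha hb hc hd he (fanoutFn_mem_FP hf (fanoutFn_mem_FP hg (fanoutFn_mem_FP hh (fanoutFn_mem_FP hi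
    (fanoutFn_mem_FP hj (fanoutFn_mem_FP hk hl))))))

/-- `mkW` applied. [folklore] -/
theorem mkW_apply (a b c d e f g h i j k l : List Bool → List Bool) (z : List Bool) :
    mkW a b c d e f g h i j k l z = rec6 (a z) (b z) (c z) (d z) (e z)
      (boolPair (f z) (boolPair (g z) (boolPair (h z) (boolPair (i z) (boolPair (j z) (boolPair (k z) (l z))))))) := by
  simp [mkW, mk6]

/-- The fields of the record of a machine state. [folklore] -/
theorem fields_recOf (d E co : List Bool) (m : MS N) :
    dF (recOf d E co m) = d ∧ eF (recOf d E co m) = E ∧ coF (recOf d E co m) = co ∧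
      wF (recOf d E co m) = List.ofFn m.s.1 ∧ phF (recOf d E co m) = ones m.s.2.1 ∧
      vbF (recOf d E co m) = [m.s.2.2] ∧ anF (recOf d E co m) = m.an ∧ okF (recOf d E co m) = [m.ok] ∧
      hhF (recOf d E co m) = ones m.hh ∧ cdF (recOf d E co m) = m.cd ∧ flF (recOf d E co m) = [m.fl] ∧
      outF (recOf d E co m) = m.out := by
  simp [recOf, tailOf, Brick.nthF_zero, nthF, sndPow]

/-- All twelve fields together are not longer than the record. [folklore] -/
theorem length_fields12_le (z : List Bool) :
    2 * ((dF z).length + (eF z).length + (coF z).length + (wF z).length + (phF z).length + (vbF z).length +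
      (anF z).length + (okF z).length + (hhF z).length + (cdF z).length + (flF z).length) + (outF z).length ≤ z.length := by
  have h := length_fields_le z
  have h5 : 2 * (nthF 5 z).length + (sndPow 5 z).length ≤ (sndPow 4 z).length := length_nthF_succ_add_sndPow_succ_le 4 z
  have h6 : 2 * (nthF 6 z).length + (sndPow 6 z).length ≤ (sndPow 5 z).length := length_nthF_succ_add_sndPow_succ_le 5 z
  have h7 : 2 * (nthF 7 z).length + (sndPow 7 z).length ≤ (sndPow 6 z).length := length_nthF_succ_add_sndPow_succ_le 6 z
  have h8 : 2 * (nthF 8 z).length + (sndPow 8 z).length ≤ (sndPow 7 z).length := length_nthF_succ_add_sndPow_succ_le 7 z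
  have h9 : 2 * (nthF 9 z).length + (sndPow 9 z).length ≤ (sndPow 8 z).length := length_nthF_succ_add_sndPow_succ_le 8 z
  have h10 : 2 * (nthF 10 z).length + (sndPow 10 z).length ≤ (sndPow 9 z).length := length_nthF_succ_add_sndPow_succ_le 9 z
  show 2 * ((nthF 0 z).length + (nthF 1 z).length + (nthF 2 z).length + (nthF 3 z).length + (nthF 4 z).length +
    (nthF 5 z).length + (nthF 6 z).length + (nthF 7 z).length + (nthF 8 z).length + (nthF 9 z).length +
    (nthF 10 z).length) + (sndPow 10 z).length ≤ z.length
  have h' : 2 * ((nthF 0 z).length + (nthF 1 z).length + (nthF 2 z).length + (nthF 3 z).length +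
    (nthF 4 z).length) + (sndPow 4 z).length ≤ z.length := h
  omega

/-- The length of a twelve-field record in terms of its fields. [folklore] -/
theorem length_rec12 (d E co w ph vb an ok hh cd fl out : List Bool) :
    (rec6 d E co w ph (boolPair vb (boolPair an (boolPair ok (boolPair hh (boolPair cd (boolPair fl out))))))).length =
      2 * (d.length + E.length + co.length + w.length + ph.length + vb.length + an.length + ok.length + hh.length +
        cd.length + fl.length) + out.length + 22 := by
  simp only [rec6, length_boolPair]; ring

/-! ### New one-gate data: the guessed bit, the answer bit, the oracle-gate pieces -/

/-- The coins after the two read by this gate. [folklore] -/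
def coNxF : List Bool → List Bool := List.tail ∘ List.tail ∘ coF
/-- The guessed answer bit (second unread coin). [folklore] -/
def aT : List Bool → List Bool := bitT (List.tail ∘ coF)
/-- The supplied answer bit (first unread answer). [folklore] -/
def anT : List Bool → List Bool := bitT anF
/-- The answers after it. [folklore] -/
def an'F : List Bool → List Bool := List.tail ∘ anF
/-- The countdown after this round. [folklore] -/
def cd'F : List Bool → List Bool := List.tail ∘ cdF
/-- The tag bit of the gate code (`1` = oracle gate). [folklore] -/
def tagT : List Bool → List Bool := bitT gF
/-- The validity bit, normalised. [folklore] -/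
def vbT : List Bool → List Bool := eqC [true] vbF
/-- The validity bit after a non-branching gate: cleared by a choice bit `1`. [folklore] -/
def vb'T : List Bool → List Bool := andFn vbT (notFn cT)
/-- The consistency bit, normalised. [folklore] -/
def okcT : List Bool → List Bool := eqC [true] okF
/-- The written-flag, normalised. [folklore] -/
def flT : List Bool → List Bool := eqC [true] flF
/-- The written-flag after this round: raised when the countdown is empty. [folklore] -/
def flN : List Bool → List Bool := orFn flT (nilT cdF)
/-- Is this the writing round (countdown empty, nothing written yet)? [folklore] -/
def wrT : List Bool → List Bool := andFn (nilT cdF) (notFn flT)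
/-- The output after this round, for a query function `q`. [folklore] -/
def outN (q : List Bool → List Bool) : List Bool → List Bool := iteFn wrT q outF
/-- The equivalence (XNOR) of two one-bit conditions. [folklore] -/
def eqvT (a b : List Bool → List Bool) : List Bool → List Bool := iteFn a b (notFn b)
/-- The Hadamard counter incremented. [folklore] -/
def hh1F : List Bool → List Bool := OracleCompose.concatFn ∘ pr hhF (fun _ => [true])

/-- The unary arity `1^{k+1}` of an oracle-gate code `1 ⟨bin k, ⟨1^{k+1}, wires⟩⟩`. [folklore] -/
def arF : List Bool → List Bool := fstF ∘ sndF ∘ gtF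
/-- `1^k`: the arity without one symbol. [folklore] -/
def arkF : List Bool → List Bool := List.tail ∘ arF

/-- **The gathering step**: on `⟨⟨label, wires⟩, ⟨a, acc⟩⟩`, append to `acc` the label bit at the
unary position `1^{min ⟦a⟧ |label|}`. [folklore] -/
def gaStep : List Bool → List Bool :=
  OracleCompose.concatFn ∘ pr (sndF ∘ sndF)
    (bitAtFn ∘ pr (binToUnaryFn ∘ pr (fstF ∘ fstF) (fstF ∘ sndF)) (fstF ∘ fstF))
/-- **The gathered label bits** on all the wires of the oracle gate (a list fold over the wire
codes). [folklore] -/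
def gaF : List Bool → List Bool := foldFn gaStep (fun _ => []) ∘ pr wF wsF
/-- **The query**: the gathered bits on the first `k` wires. [cite: BennettBernsteinBrassardVazirani1997, §3] -/
def qF : List Bool → List Bool := takeFn ∘ pr arkF gaF
/-- The binary code of the answer wire (item `k` of the wire list). [folklore] -/
def tcF : List Bool → List Bool := fstF ∘ dropItemsFn ∘ pr arkF wsF
/-- The answer wire in unary, capped by the label length. [folklore] -/
def utF : List Bool → List Bool := binToUnaryFn ∘ pr wF tcF
/-- The label bit on the answer wire. [folklore] -/
def wtT : List Bool → List Bool := bitT (bitAtFn ∘ pr utF wF)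

/-! ### The branches of the round -/

/-- A branch of the round: the common bookkeeping (gate split off, two coins and one answer read,
consistency, countdown, flag, output) around the gate-specific label `w`, phase `ph`, validity
`vb`, consistency test `okb`, counter `hh` and query `q`. [folklore] -/
def brW (w ph vb okb hh q : List Bool → List Bool) : List Bool → List Bool :=
  mkW dF e'F coNxF w ph vb an'F (andFn okcT okb) hh cd'F flN (outN q)

/-- The record after an `H` gate. [cite: AdlemanDeMarraisHuang1997, §6 Lemma 6.10 (proof, step 3)] -/
def hW : List Bool → List Bool :=
  brW (setF uiF cT) (iteFn (andFn wiT cT) (addPh 4) (addPh 0)) vbT (notFn aT) hh1F (fun _ => [])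
/-- The record after an `S` gate. [cite: AdlemanDeMarraisHuang1997, §6 Lemma 6.10 (proof, step 3)] -/
def sW : List Bool → List Bool := brW wF (iteFn wiT (addPh 2) (addPh 0)) vb'T (notFn aT) hhF (fun _ => [])
/-- The record after a `T` gate. [cite: AdlemanDeMarraisHuang1997, §6 Lemma 6.10 (proof, step 3)] -/
def tW : List Bool → List Bool := brW wF (iteFn wiT (addPh 1) (addPh 0)) vb'T (notFn aT) hhF (fun _ => [])
/-- The record after a `CNOT` gate. [cite: AdlemanDeMarraisHuang1997, §6 Lemma 6.10 (proof, step 3)] -/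
def cW : List Bool → List Bool := brW (setF ujF (xorT wjT wiT)) (addPh 0) vb'T (notFn aT) hhF (fun _ => [])
/-- **The record after an ORACLE gate**: the guessed answer bit XORed into the answer wire, the
guess compared with the supplied answer, the query offered to the output.
[cite: BennettBernsteinBrassardVazirani1997, §3] [cite: FortnowRogers1999JCSS, §3 ("Theorem 3.1 relativizes")] -/
def oW : List Bool → List Bool := brW (setF utF (xorT wtT aT)) (addPh 0) vb'T (eqvT aT anT) hhF qF
/-- The record re-assembled unchanged (no gate ahead). [folklore] -/
def idleW : List Bool → List Bool := mkW dF eF coF wF phF vbF anF okF hhF cdF flF outF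

/-- **One round of the walk**: idle if no gate is ahead; otherwise dispatch on the tag bit (oracle
gate) and on the gate symbol. [cite: AdlemanDeMarraisHuang1997, §6 Lemma 6.10 (proof, step 3)] [cite: AroraBarak2009, §3.4] -/
def roundW : List Bool → List Bool :=
  iteFn (nilT eF) idleW (iteFn tagT oW (iteFn (nilT opF) hW (iteFn (eqC [true] opF) sW
    (iteFn (eqC [false, true] opF) tW cW))))

/-! ### Membership in `FP` -/

/-- `coNxF` is in `FP`. [folklore] -/
theorem coNxF_mem_FP : coNxF ∈ FP := comp_mem_FP PRelSigma.tail_mem_FP (comp_mem_FP PRelSigma.tail_mem_FP (nthF_mem_FP 2))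
/-- `aT` is in `FP`. [folklore] -/
theorem aT_mem_FP : aT ∈ FP := bitT_mem_FP (comp_mem_FP PRelSigma.tail_mem_FP (nthF_mem_FP 2))
/-- `anT` is in `FP`. [folklore] -/
theorem anT_mem_FP : anT ∈ FP := bitT_mem_FP (nthF_mem_FP 6)
/-- `an'F` is in `FP`. [folklore] -/
theorem an'F_mem_FP : an'F ∈ FP := comp_mem_FP PRelSigma.tail_mem_FP (nthF_mem_FP 6)
/-- `cd'F` is in `FP`. [folklore] -/
theorem cd'F_mem_FP : cd'F ∈ FP := comp_mem_FP PRelSigma.tail_mem_FP (nthF_mem_FP 9)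
/-- `tagT` is in `FP`. [folklore] -/
theorem tagT_mem_FP : tagT ∈ FP := bitT_mem_FP gF_mem_FP
/-- `vbT` is in `FP`. [folklore] -/
theorem vbT_mem_FP : vbT ∈ FP := eqC_mem_FP _ (nthF_mem_FP 5)
/-- `vb'T` is in `FP`. [folklore] -/
theorem vb'T_mem_FP : vb'T ∈ FP := andFn_mem_FP vbT_mem_FP (notFn_mem_FP cT_mem_FP)
/-- `okcT` is in `FP`. [folklore] -/
theorem okcT_mem_FP : okcT ∈ FP := eqC_mem_FP _ (nthF_mem_FP 7)
/-- `flT` is in `FP`. [folklore] -/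
theorem flT_mem_FP : flT ∈ FP := eqC_mem_FP _ (nthF_mem_FP 10)
/-- `flN` is in `FP`. [folklore] -/
theorem flN_mem_FP : flN ∈ FP := orFn_mem_FP flT_mem_FP (nilT_mem_FP (nthF_mem_FP 9))
/-- `wrT` is in `FP`. [folklore] -/
theorem wrT_mem_FP : wrT ∈ FP := andFn_mem_FP (nilT_mem_FP (nthF_mem_FP 9)) (notFn_mem_FP flT_mem_FP)
/-- `outN q` is in `FP` for `q ∈ FP`. [folklore] -/
theorem outN_mem_FP {q : List Bool → List Bool} (hq : q ∈ FP) : outN q ∈ FP := iteFn_mem_FP wrT_mem_FP hq (sndPow_mem_FP 10)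
/-- `eqvT a b` is in `FP`. [folklore] -/
theorem eqvT_mem_FP {a b : List Bool → List Bool} (ha : a ∈ FP) (hb : b ∈ FP) : eqvT a b ∈ FP :=
  iteFn_mem_FP ha hb (notFn_mem_FP hb)
/-- `hh1F` is in `FP`. [folklore] -/
theorem hh1F_mem_FP : hh1F ∈ FP :=
  comp_mem_FP OracleCompose.concatFn_mem_FP (fanoutFn_mem_FP (nthF_mem_FP 8) (const_mem_FP _))
/-- `arF` is in `FP`. [folklore] -/
theorem arF_mem_FP : arF ∈ FP := comp_mem_FP fstF_mem_FP (comp_mem_FP sndF_mem_FP gtF_mem_FP)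
/-- `arkF` is in `FP`. [folklore] -/
theorem arkF_mem_FP : arkF ∈ FP := comp_mem_FP PRelSigma.tail_mem_FP arF_mem_FP
/-- `gaStep` is in `FP`. [folklore] -/
theorem gaStep_mem_FP : gaStep ∈ FP :=
  comp_mem_FP OracleCompose.concatFn_mem_FP (fanoutFn_mem_FP (comp_mem_FP sndF_mem_FP sndF_mem_FP)
    (comp_mem_FP bitAtFn_mem_FP (fanoutFn_mem_FP
      (comp_mem_FP binToUnaryFn_mem_FP (fanoutFn_mem_FP (comp_mem_FP fstF_mem_FP fstF_mem_FP) (comp_mem_FP fstF_mem_FP sndF_mem_FP)))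
      (comp_mem_FP fstF_mem_FP fstF_mem_FP))))

/-- Value of the gathering step on a step argument. [folklore] -/
theorem gaStep_apply (z : List Bool) :
    gaStep z = sndF (sndF z) ++ ((fstF (fstF z)).drop (min (bitsToNat (fstF (sndF z))) (fstF (fstF z)).length)).take 1 := by
  simp [gaStep]

/-- The gathering step appends at most one bit (`FoldGrowth 1`). [folklore] -/
theorem foldGrowth_gaStep : FoldGrowth 1 gaStep := fun v => by
  rw [gaStep_apply, List.length_append]
  have := List.length_take_le 1 ((fstF (fstF v)).drop (min (bitsToNat (fstF (sndF v))) (fstF (fstF v)).length))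
  omega

/-- `gaF` is in `FP`. [folklore] -/
theorem gaF_mem_FP : gaF ∈ FP :=
  comp_mem_FP (foldFn_mem_FP gaStep_mem_FP (const_mem_FP _) foldGrowth_gaStep) (fanoutFn_mem_FP (nthF_mem_FP 3) wsF_mem_FP)
/-- `qF` is in `FP`. [folklore] -/
theorem qF_mem_FP : qF ∈ FP := comp_mem_FP takeFn_mem_FP (fanoutFn_mem_FP arkF_mem_FP gaF_mem_FP)
/-- `tcF` is in `FP`. [folklore] -/
theorem tcF_mem_FP : tcF ∈ FP :=
  comp_mem_FP fstF_mem_FP (comp_mem_FP dropItemsFn_mem_FP (fanoutFn_mem_FP arkF_mem_FP wsF_mem_FP))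
/-- `utF` is in `FP`. [folklore] -/
theorem utF_mem_FP : utF ∈ FP := comp_mem_FP binToUnaryFn_mem_FP (fanoutFn_mem_FP (nthF_mem_FP 3) tcF_mem_FP)
/-- `wtT` is in `FP`. [folklore] -/
theorem wtT_mem_FP : wtT ∈ FP := bitT_mem_FP (comp_mem_FP bitAtFn_mem_FP (fanoutFn_mem_FP utF_mem_FP (nthF_mem_FP 3)))

/-- `brW` of `FP` functions is in `FP`. [folklore] -/
theorem brW_mem_FP {w ph vb okb hh q : List Bool → List Bool} (hw : w ∈ FP) (hph : ph ∈ FP) (hvb : vb ∈ FP)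
    (hokb : okb ∈ FP) (hhh : hh ∈ FP) (hq : q ∈ FP) : brW w ph vb okb hh q ∈ FP :=
  mkW_mem_FP (nthF_mem_FP 0) e'F_mem_FP coNxF_mem_FP hw hph hvb an'F_mem_FP (andFn_mem_FP okcT_mem_FP hokb) hhh
    cd'F_mem_FP flN_mem_FP (outN_mem_FP hq)

/-- `hW` is in `FP`. [folklore] -/
theorem hW_mem_FP : hW ∈ FP :=
  brW_mem_FP (setF_mem_FP uiF_mem_FP cT_mem_FP) (iteFn_mem_FP (andFn_mem_FP wiT_mem_FP cT_mem_FP) (addPh_mem_FP 4) (addPh_mem_FP 0))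
    vbT_mem_FP (notFn_mem_FP aT_mem_FP) hh1F_mem_FP (const_mem_FP _)
/-- `sW` is in `FP`. [folklore] -/
theorem sW_mem_FP : sW ∈ FP :=
  brW_mem_FP (nthF_mem_FP 3) (iteFn_mem_FP wiT_mem_FP (addPh_mem_FP 2) (addPh_mem_FP 0)) vb'T_mem_FP
    (notFn_mem_FP aT_mem_FP) (nthF_mem_FP 8) (const_mem_FP _)
/-- `tW` is in `FP`. [folklore] -/
theorem tW_mem_FP : tW ∈ FP :=
  brW_mem_FP (nthF_mem_FP 3) (iteFn_mem_FP wiT_mem_FP (addPh_mem_FP 1) (addPh_mem_FP 0)) vb'T_mem_FP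
    (notFn_mem_FP aT_mem_FP) (nthF_mem_FP 8) (const_mem_FP _)
/-- `cW` is in `FP`. [folklore] -/
theorem cW_mem_FP : cW ∈ FP :=
  brW_mem_FP (setF_mem_FP ujF_mem_FP (xorT_mem_FP wjT_mem_FP wiT_mem_FP)) (addPh_mem_FP 0) vb'T_mem_FP
    (notFn_mem_FP aT_mem_FP) (nthF_mem_FP 8) (const_mem_FP _)
/-- `oW` is in `FP`. [folklore] -/
theorem oW_mem_FP : oW ∈ FP :=
  brW_mem_FP (setF_mem_FP utF_mem_FP (xorT_mem_FP wtT_mem_FP aT_mem_FP)) (addPh_mem_FP 0) vb'T_mem_FP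
    (eqvT_mem_FP aT_mem_FP anT_mem_FP) (nthF_mem_FP 8) qF_mem_FP
/-- `idleW` is in `FP`. [folklore] -/
theorem idleW_mem_FP : idleW ∈ FP :=
  mkW_mem_FP (nthF_mem_FP 0) (nthF_mem_FP 1) (nthF_mem_FP 2) (nthF_mem_FP 3) (nthF_mem_FP 4) (nthF_mem_FP 5)
    (nthF_mem_FP 6) (nthF_mem_FP 7) (nthF_mem_FP 8) (nthF_mem_FP 9) (nthF_mem_FP 10) (sndPow_mem_FP 10)

/-- **`roundW ∈ FP`.** [cite: AroraBarak2009, §1.3] -/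
theorem roundW_mem_FP : roundW ∈ FP :=
  iteFn_mem_FP (nilT_mem_FP (nthF_mem_FP 1)) idleW_mem_FP (iteFn_mem_FP tagT_mem_FP oW_mem_FP
    (iteFn_mem_FP (nilT_mem_FP opF_mem_FP) hW_mem_FP (iteFn_mem_FP (eqC_mem_FP _ opF_mem_FP) sW_mem_FP
      (iteFn_mem_FP (eqC_mem_FP _ opF_mem_FP) tW_mem_FP cW_mem_FP))))

/-! ### Values of the pieces on every string -/

/-- Value of `tagT`. [folklore] -/
theorem tagT_apply (z : List Bool) : tagT z = [headBit (gF z)] := bitT_apply _ _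
/-- Value of `aT`. [folklore] -/
theorem aT_apply (z : List Bool) : aT z = [headBit (coF z).tail] := bitT_apply _ _
/-- Value of `anT`. [folklore] -/
theorem anT_apply (z : List Bool) : anT z = [headBit (anF z)] := bitT_apply _ _
/-- Value of `vbT`. [folklore] -/
theorem vbT_apply (z : List Bool) : vbT z = [decide (vbF z = [true])] := eqC_apply _ _ _
/-- Value of `vb'T`. [folklore] -/
theorem vb'T_apply (z : List Bool) : vb'T z = [decide (vbF z = [true]) && !headBit (coF z)] := by
  rw [vb'T, andFn_apply (vbT_apply z) (notFn_apply (show cT z = [headBit (coF z)] by simp [cT]))]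
/-- Value of `okcT`. [folklore] -/
theorem okcT_apply (z : List Bool) : okcT z = [decide (okF z = [true])] := eqC_apply _ _ _
/-- Value of `flT`. [folklore] -/
theorem flT_apply (z : List Bool) : flT z = [decide (flF z = [true])] := eqC_apply _ _ _
/-- Value of `flN`. [folklore] -/
theorem flN_apply (z : List Bool) : flN z = [decide (flF z = [true]) || decide (cdF z = [])] := by
  rw [flN, orFn_apply (flT_apply z) (nilT_apply cdF z)]
/-- Value of `wrT`. [folklore] -/
theorem wrT_apply (z : List Bool) : wrT z = [decide (cdF z = []) && !decide (flF z = [true])] := by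
  rw [wrT, andFn_apply (nilT_apply cdF z) (notFn_apply (flT_apply z))]
/-- Value of `outN q`. [folklore] -/
theorem outN_apply (q : List Bool → List Bool) (z : List Bool) :
    outN q z = if cdF z = [] ∧ ¬ flF z = [true] then q z else outF z := by
  rw [outN, iteFn_apply (wrT_apply z)]
  by_cases h1 : cdF z = [] <;> by_cases h2 : flF z = [true] <;> simp [h1, h2]
/-- Value of `eqvT` on Boolean-modelled conditions. [folklore] -/
theorem eqvT_apply {a b : List Bool → List Bool} {z : List Bool} {x y : Bool} (ha : a z = [x]) (hb : b z = [y]) :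
    eqvT a b z = [x == y] := by
  rw [eqvT, iteFn_apply ha]
  cases x
  · rw [if_neg (by simp), notFn_apply hb]; cases y <;> rfl
  · rw [if_pos rfl, hb]; cases y <;> rfl
/-- Value of `hh1F`. [folklore] -/
theorem hh1F_apply (z : List Bool) : hh1F z = hhF z ++ [true] := by simp [hh1F]

/-- The gathering of label bits the fold computes: starting from `acc`, append for each wire code
`a` the label bit at position `min ⟦a⟧ |label|` (nothing if out of range). [folklore] -/
def gatherL (lab : List Bool) (ws : List (List Bool)) (acc : List Bool) : List Bool :=
  ws.foldl (fun acc a => acc ++ (lab.drop (min (bitsToNat a) lab.length)).take 1) acc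

/-- Gathering appends at most one bit per wire code. [folklore] -/
theorem length_gatherL_le (lab : List Bool) : ∀ (ws : List (List Bool)) (acc : List Bool),
    (gatherL lab ws acc).length ≤ acc.length + ws.length := by
  intro ws
  induction ws with
  | nil => intro acc; simp [gatherL]
  | cons a ws ih =>
    intro acc
    have h := ih (acc ++ (lab.drop (min (bitsToNat a) lab.length)).take 1)
    have h1 := List.length_take_le 1 (lab.drop (min (bitsToNat a) lab.length))
    simp only [gatherL, List.foldl_cons, List.length_cons] at h ⊢
    rw [List.length_append] at h
    exact h.trans (by omega)

/-- **Gathering the bits of a label on genuine wire numbers** reads the label on those wires.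
[folklore] -/
theorem gatherL_ofFn (w : QReg N) : ∀ (js : List (Fin N)) (acc : List Bool),
    gatherL (List.ofFn w) (js.map fun j : Fin N => encodeNat j.val) acc = acc ++ js.map w := by
  intro js
  induction js with
  | nil => intro acc; simp [gatherL]
  | cons j js ih =>
    intro acc
    have hj : min j.val N = j.val := min_eq_left j.isLt.le
    have h1 : ((List.ofFn w).drop (min (bitsToNat (encodeNat j.val)) (List.ofFn w).length)).take 1 = [w j] := by
      rw [bitsToNat_encodeNat, List.length_ofFn, hj, List.take_one_drop_eq_of_lt_length (by simp)]
      simp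
    have h := ih (acc ++ [w j])
    simp only [gatherL, List.map_cons, List.foldl_cons] at h ⊢
    rw [h1, h]
    simp

/-- **Value of `gaF` on every string**: the gathering over the items of the wire field. [folklore] -/
theorem gaF_apply (z : List Bool) : gaF z = gatherL (wF z) (decNil (wsF z)) [] := by
  simp only [gaF, Function.comp_apply, fanoutFn_apply, foldFn_boolPair, gatherL]
  refine congrArg (fun f => List.foldl f [] (decNil (wsF z))) (funext fun acc => funext fun a => ?_)
  rw [gaStep_apply]
  simp

/-- `|gaF z| ≤ |gF z|` on every string (one bit per item of the wire field, a part of the gate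
code). [folklore] -/
theorem length_gaF_le (z : List Bool) : (gaF z).length ≤ (gF z).length := by
  rw [gaF_apply]
  refine (length_gatherL_le _ _ _).trans ?_
  rw [List.length_nil, zero_add]
  refine (length_decNil_le _).trans ?_
  have h1 := length_fstF_sndF_le (gtF z)
  have h2 := length_fstF_sndF_le (sndF (gtF z))
  have h3 : (gtF z).length ≤ (gF z).length := by simp only [gtF, Function.comp_apply, List.length_tail]; omega
  simp only [wsF, Function.comp_apply]
  omega

/-- `|qF z| ≤ |gF z|` on every string. [folklore] -/
theorem length_qF_le (z : List Bool) : (qF z).length ≤ (gF z).length := by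
  have h := length_gaF_le z
  simp only [qF, Function.comp_apply, fanoutFn_apply, takeFn_boolPair, List.length_take]
  exact (min_le_right _ _).trans h

/-! ### The tail of the record and its pieces -/

/-- The seven-field tail `⟨[vb], ⟨an, ⟨[ok], ⟨1^hh, ⟨cd, ⟨[fl], out⟩⟩⟩⟩⟩⟩`. [folklore] -/
def tl7 (vb : Bool) (an : List Bool) (ok : Bool) (hh : ℕ) (cd : List Bool) (fl : Bool) (out : List Bool) : List Bool :=
  boolPair [vb] (boolPair an (boolPair [ok] (boolPair (ones hh) (boolPair cd (boolPair [fl] out)))))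

/-- The record of a machine state has the tail `tl7`. [folklore] -/
theorem recOf_eq (d E co : List Bool) (m : MS N) :
    recOf d E co m = rec6 d E co (List.ofFn m.s.1) (ones m.s.2.1) (tl7 m.s.2.2 m.an m.ok m.hh m.cd m.fl m.out) := rfl

section TailPieces

variable (d E co wl ph : List Bool) (vb : Bool) (an : List Bool) (ok : Bool) (hh : ℕ) (cd : List Bool)
  (fl : Bool) (out : List Bool)

/-- The new fields of a record with tail `tl7`. [folklore] -/
theorem tfields_rec6 :
    vbF (rec6 d E co wl ph (tl7 vb an ok hh cd fl out)) = [vb] ∧ anF (rec6 d E co wl ph (tl7 vb an ok hh cd fl out)) = an ∧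
      okF (rec6 d E co wl ph (tl7 vb an ok hh cd fl out)) = [ok] ∧ hhF (rec6 d E co wl ph (tl7 vb an ok hh cd fl out)) = ones hh ∧
      cdF (rec6 d E co wl ph (tl7 vb an ok hh cd fl out)) = cd ∧ flF (rec6 d E co wl ph (tl7 vb an ok hh cd fl out)) = [fl] ∧
      outF (rec6 d E co wl ph (tl7 vb an ok hh cd fl out)) = out := by
  simp [tl7, nthF, sndPow]

/-- Two coins are dropped by two tails. [folklore] -/
theorem tail_tail_eq_drop_two (co : List Bool) : co.tail.tail = co.drop 2 := by
  rcases co with _ | ⟨a, _ | ⟨b, co⟩⟩ <;> rfl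

/-- The derived one-gate data of a record with tail `tl7`. [folklore] -/
theorem tpieces_rec6 :
    coNxF (rec6 d E co wl ph (tl7 vb an ok hh cd fl out)) = co.drop 2 ∧
      aT (rec6 d E co wl ph (tl7 vb an ok hh cd fl out)) = [headBit co.tail] ∧
      anT (rec6 d E co wl ph (tl7 vb an ok hh cd fl out)) = [headBit an] ∧
      an'F (rec6 d E co wl ph (tl7 vb an ok hh cd fl out)) = an.tail ∧
      cd'F (rec6 d E co wl ph (tl7 vb an ok hh cd fl out)) = cd.tail ∧
      vbT (rec6 d E co wl ph (tl7 vb an ok hh cd fl out)) = [vb] ∧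
      vb'T (rec6 d E co wl ph (tl7 vb an ok hh cd fl out)) = [vb && !headBit co] ∧
      okcT (rec6 d E co wl ph (tl7 vb an ok hh cd fl out)) = [ok] ∧
      hh1F (rec6 d E co wl ph (tl7 vb an ok hh cd fl out)) = ones (hh + 1) ∧
      flN (rec6 d E co wl ph (tl7 vb an ok hh cd fl out)) = [fl || decide (cd = [])] ∧
      (∀ q, outN q (rec6 d E co wl ph (tl7 vb an ok hh cd fl out)) =
        if cd = [] ∧ fl = false then q (rec6 d E co wl ph (tl7 vb an ok hh cd fl out)) else out) := by
  obtain ⟨hvb, han, hok, hhh, hcd, hfl, hout⟩ := tfields_rec6 d E co wl ph vb an ok hh cd fl out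
  have hco : coF (rec6 d E co wl ph (tl7 vb an ok hh cd fl out)) = co := by simp [nthF]
  refine ⟨?_, by rw [aT_apply, hco], by rw [anT_apply, han], ?_, ?_, by rw [vbT_apply, hvb]; cases vb <;> rfl,
    by rw [vb'T_apply, hvb, hco]; cases vb <;> rfl, by rw [okcT_apply, hok]; cases ok <;> rfl,
    by rw [hh1F_apply, hhh]; simp [ones, List.replicate_succ'], by rw [flN_apply, hfl, hcd]; cases fl <;> simp,
    fun q => ?_⟩
  · simp only [coNxF, Function.comp_apply, hco, tail_tail_eq_drop_two]
  · simp only [an'F, Function.comp_apply, han]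
  · simp only [cd'F, Function.comp_apply, hcd]
  · rw [outN_apply, hcd, hfl, hout]
    cases fl <;> simp

end TailPieces

/-! ### The round as a case distinction; growth; the clocked walk -/

/-- `roundW` as an honest case distinction, on every string. [folklore] -/
theorem roundW_eq (z : List Bool) :
    roundW z = if eF z = [] then idleW z else if headBit (gF z) = true then oW z else if opF z = [] then hW z else
      if opF z = [true] then sW z else if opF z = [false, true] then tW z else cW z := by
  rw [roundW, iteFn_apply (nilT_apply eF z)]
  by_cases h0 : eF z = []
  · simp [h0]
  rw [if_neg (by simpa using h0), if_neg h0, iteFn_apply (tagT_apply z)]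
  by_cases ht : headBit (gF z) = true
  · simp [ht]
  rw [if_neg ht, if_neg ht, iteFn_apply (nilT_apply opF z)]
  by_cases h1 : opF z = []
  · simp [h1]
  rw [if_neg (by simpa using h1), if_neg h1, iteFn_apply (eqC_apply _ opF z)]
  by_cases h2 : opF z = [true]
  · simp [h2]
  rw [if_neg (by simpa using h2), if_neg h2, iteFn_apply (eqC_apply _ opF z)]
  by_cases h3 : opF z = [false, true]
  · simp [h3]
  · rw [if_neg (by simpa using h3), if_neg h3]

/-- The constant bounding the growth of one round. [folklore] -/
def roundGrowthW : ℕ := 48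

/-- Growth of a branch `brW`, on every string: with a label at most one bit longer, a phase of at
most `7` symbols, one-bit validity and consistency tests, a counter at most one symbol longer and
a query not longer than the gate code, the record grows by at most `48`. [folklore] -/
theorem length_brW_le {w ph vb okb hh q : List Bool → List Bool} (z : List Bool) (hw : (w z).length ≤ (wF z).length + 1)
    (hph : (ph z).length ≤ 7) (hvb : (vb z).length = 1) (hokb : ∃ b, okb z = [b]) (hhh : (hh z).length ≤ (hhF z).length + 1)
    (hq : (q z).length ≤ (gF z).length) : (brW w ph vb okb hh q z).length ≤ z.length + roundGrowthW := by
  have hf := length_fields12_le z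
  have h1 : 2 * (gF z).length + (e'F z).length ≤ (eF z).length := by
    simpa [gF, e'F] using length_fstF_sndF_le (eF z)
  have h2 : (coNxF z).length ≤ (coF z).length := by simp only [coNxF, Function.comp_apply, List.length_tail]; omega
  have h3 : (an'F z).length ≤ (anF z).length := by simp only [an'F, Function.comp_apply, List.length_tail]; omega
  have h4 : (cd'F z).length ≤ (cdF z).length := by simp only [cd'F, Function.comp_apply, List.length_tail]; omega
  obtain ⟨b, hb⟩ := hokb
  have h5 : (andFn okcT okb z).length = 1 := by rw [andFn_apply (okcT_apply z) hb]; rfl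
  have h6 : (flN z).length = 1 := by rw [flN_apply]; rfl
  have h7 : (outN q z).length ≤ (outF z).length + (gF z).length := by
    rw [outN_apply]; split_ifs <;> omega
  rw [brW, mkW_apply, length_rec12]
  simp only [roundGrowthW]
  omega

/-- Constant growth of `hW`. [folklore] -/
theorem length_hW_le (z : List Bool) : (hW z).length ≤ z.length + roundGrowthW :=
  length_brW_le z (length_setF_le uiF cT z (by simp [cT]))
    (length_itePh_le (andFn_apply (wiT_apply z) (show cT z = [headBit (coF z)] by simp [cT])) 4 0)
    (by rw [vbT_apply]; rfl) ⟨_, notFn_apply (aT_apply z)⟩ (by rw [hh1F_apply]; simp) (by simp)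
/-- Constant growth of `sW`. [folklore] -/
theorem length_sW_le (z : List Bool) : (sW z).length ≤ z.length + roundGrowthW :=
  length_brW_le z (by simp) (length_itePh_le (wiT_apply z) 2 0) (by rw [vb'T_apply]; rfl) ⟨_, notFn_apply (aT_apply z)⟩
    (by simp) (by simp)
/-- Constant growth of `tW`. [folklore] -/
theorem length_tW_le (z : List Bool) : (tW z).length ≤ z.length + roundGrowthW :=
  length_brW_le z (by simp) (length_itePh_le (wiT_apply z) 1 0) (by rw [vb'T_apply]; rfl) ⟨_, notFn_apply (aT_apply z)⟩
    (by simp) (by simp)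
/-- Constant growth of `cW`. [folklore] -/
theorem length_cW_le (z : List Bool) : (cW z).length ≤ z.length + roundGrowthW :=
  length_brW_le z (length_setF_le ujF (xorT wjT wiT) z (by rw [xorT_apply (wjT_apply z) (wiT_apply z)]; rfl))
    (length_addPh_le 0 z) (by rw [vb'T_apply]; rfl) ⟨_, notFn_apply (aT_apply z)⟩ (by simp) (by simp)
/-- Value of `wtT`. [folklore] -/
theorem wtT_apply (z : List Bool) : wtT z = [headBit (bitAtFn (boolPair (utF z) (wF z)))] := by simp [wtT]
/-- Constant growth of `oW`. [folklore] -/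
theorem length_oW_le (z : List Bool) : (oW z).length ≤ z.length + roundGrowthW :=
  length_brW_le z (length_setF_le utF (xorT wtT aT) z (by rw [xorT_apply (wtT_apply z) (aT_apply z)]; rfl))
    (length_addPh_le 0 z) (by rw [vb'T_apply]; rfl) ⟨_, eqvT_apply (aT_apply z) (anT_apply z)⟩ (by simp) (length_qF_le z)
/-- Constant growth of `idleW`. [folklore] -/
theorem length_idleW_le (z : List Bool) : (idleW z).length ≤ z.length + roundGrowthW := by
  have hf := length_fields12_le z
  rw [idleW, mkW_apply, length_rec12]
  simp only [roundGrowthW]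
  omega

/-- **Constant growth**: `|roundW z| ≤ |z| + 48` on every string. [folklore] -/
theorem length_roundW_le (z : List Bool) : (roundW z).length ≤ z.length + roundGrowthW := by
  rw [roundW_eq]
  split_ifs
  exacts [length_idleW_le z, length_oW_le z, length_hW_le z, length_sW_le z, length_tW_le z, length_cW_le z]

/-- **The first field is kept**, on every string. [folklore] -/
theorem fstF_roundW (z : List Bool) : fstF (roundW z) = fstF z := by
  rw [roundW_eq]
  split_ifs <;> simp [idleW, oW, hW, sW, tW, cW, brW, mkW_apply, Brick.nthF_zero]

/-- **The walk**: `|d|` rounds of `roundW`. [cite: AroraBarak2009, §1.4.1 (clocked loops)] -/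
def passW : List Bool → List Bool := fun r => roundW^[(X : Polynomial ℕ).eval (fstF r).length] r

/-- **`passW ∈ FP`** (`iterate_mem_FP_of_growth`). [cite: AroraBarak2009, §1.3, §1.4.1] -/
theorem passW_mem_FP : passW ∈ FP :=
  iterate_mem_FP_of_growth roundW_mem_FP roundGrowthW fstF_roundW
    (fun w => (length_roundW_le w).trans (by nlinarith [Nat.zero_le (boolUnpair w).1.length])) X

/-- The walk on a record: `passW` runs `|d|` rounds. [folklore] -/
theorem passW_rec6 (d E co wl ph v : List Bool) : passW (rec6 d E co wl ph v) = roundW^[d.length] (rec6 d E co wl ph v) := by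
  simp [passW, fstF]

/-! ### The code of an oracle gate and its pieces -/

/-- Folding wire numbers into nested pairs is the list code of their numerals. [folklore] -/
theorem foldr_boolPair_encodeNat (l : List ℕ) :
    l.foldr (fun a acc => boolPair (encodeNat a) acc) [] = encList (l.map encodeNat) := by
  induction l with
  | nil => rfl
  | cons a l ih => rw [List.foldr_cons, List.map_cons, encList_cons, ih]

/-- **The code of a placed oracle gate**: `1 ⟨bin k, ⟨1^{k+1}, ⟨bin i₀, ⟨⋯, ⟨bin i_k, ε⟩⟩⟩⟩⟩`.
[cite: AroraBarak2009, §6.1 (descriptions of circuits)] -/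
theorem encode_oracle (k : ℕ) (e : Fin (k + 1) ↪ Fin N) :
    QGate.encode (QGate.oracle k e : QGate cliffordT N) =
      true :: boolPair (encodeNat k) (boolPair (ones (k + 1)) (encList (List.ofFn fun i => encodeNat (e i : ℕ)))) := by
  change true :: boolPair (encodeNat k) (boolPair (unaryEncodeNat (List.ofFn fun i => ((e i : Fin N) : ℕ)).length)
    (List.foldr (fun a acc => boolPair (encodeNat a) acc) [] (List.ofFn fun i => ((e i : Fin N) : ℕ)))) = _
  rw [List.length_ofFn, OracleCompose.unaryEncodeNat_eq_replicate, foldr_boolPair_encodeNat, List.map_ofFn]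
  rfl

/-- The first `k` values of a function on `Fin (k + 1)`. [folklore] -/
theorem take_ofFn_castSucc {α : Type*} (k : ℕ) (f : Fin (k + 1) → α) :
    (List.ofFn f).take k = List.ofFn fun i : Fin k => f i.castSucc := by
  rw [List.ofFn_succ', List.concat_eq_append, List.take_append_of_le_length (by simp), List.take_of_length_le (by simp)]

/-- The last value of a function on `Fin (k + 1)`. [folklore] -/
theorem drop_ofFn_last {α : Type*} (k : ℕ) (f : Fin (k + 1) → α) : (List.ofFn f).drop k = [f (Fin.last k)] := by
  rw [List.ofFn_succ', List.concat_eq_append, List.drop_append_of_le_length (by simp), List.drop_of_length_le (by simp)]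
  rfl

section OraclePieces

variable (d : List Bool) (l : List (List Bool)) (co : List Bool) (w : QReg N) (ph v : List Bool) {k : ℕ}
  (e : Fin (k + 1) ↪ Fin N)

/-- **The round on a record whose next gate is an oracle gate: the parsed pieces** — tag `1`, the
query `queryOf e w` (gathered label bits on the first `k` wires), the answer wire `e k` in unary and
its label bit. [cite: BennettBernsteinBrassardVazirani1997, §3] -/
theorem opieces_rec6 :
    eF (rec6 d (encList ((QGate.oracle k e : QGate cliffordT N).encode :: l)) co (List.ofFn w) ph v) ≠ [] ∧
    headBit (gF (rec6 d (encList ((QGate.oracle k e : QGate cliffordT N).encode :: l)) co (List.ofFn w) ph v)) = true ∧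
    e'F (rec6 d (encList ((QGate.oracle k e : QGate cliffordT N).encode :: l)) co (List.ofFn w) ph v) = encList l ∧
    cT (rec6 d (encList ((QGate.oracle k e : QGate cliffordT N).encode :: l)) co (List.ofFn w) ph v) = [headBit co] ∧
    coF (rec6 d (encList ((QGate.oracle k e : QGate cliffordT N).encode :: l)) co (List.ofFn w) ph v) = co ∧
    dF (rec6 d (encList ((QGate.oracle k e : QGate cliffordT N).encode :: l)) co (List.ofFn w) ph v) = d ∧
    wF (rec6 d (encList ((QGate.oracle k e : QGate cliffordT N).encode :: l)) co (List.ofFn w) ph v) = List.ofFn w ∧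
    phF (rec6 d (encList ((QGate.oracle k e : QGate cliffordT N).encode :: l)) co (List.ofFn w) ph v) = ph ∧
    vF (rec6 d (encList ((QGate.oracle k e : QGate cliffordT N).encode :: l)) co (List.ofFn w) ph v) = v ∧
    qF (rec6 d (encList ((QGate.oracle k e : QGate cliffordT N).encode :: l)) co (List.ofFn w) ph v) = queryOf e w ∧
    utF (rec6 d (encList ((QGate.oracle k e : QGate cliffordT N).encode :: l)) co (List.ofFn w) ph v) =
      ones (e (Fin.last k)) ∧
    wtT (rec6 d (encList ((QGate.oracle k e : QGate cliffordT N).encode :: l)) co (List.ofFn w) ph v) =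
      [w (e (Fin.last k))] := by
  rw [encode_oracle]
  set z := rec6 d (encList ((true :: boolPair (encodeNat k) (boolPair (ones (k + 1))
    (encList (List.ofFn fun i => encodeNat (e i : ℕ))))) :: l)) co (List.ofFn w) ph v with hz
  have hE : eF z = boolPair (true :: boolPair (encodeNat k) (boolPair (ones (k + 1))
      (encList (List.ofFn fun i => encodeNat (e i : ℕ))))) (encList l) := by
    simp [hz, nthF, encList_cons]
  have hg : gF z = true :: boolPair (encodeNat k) (boolPair (ones (k + 1)) (encList (List.ofFn fun i => encodeNat (e i : ℕ)))) := by
    simp [gF, hE]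
  have hco : coF z = co := by simp [hz, nthF]
  have hw : wF z = List.ofFn w := by simp [hz, nthF]
  have hark : arkF z = ones k := by simp [arkF, arF, gtF, hg, ones, List.replicate_succ]
  have hws : wsF z = encList (List.ofFn fun i => encodeNat (e i : ℕ)) := by simp [wsF, gtF, hg]
  have hcodes : (List.ofFn fun i => encodeNat (e i : ℕ)) = (List.ofFn e).map fun j : Fin N => encodeNat j.val := by
    rw [List.map_ofFn]; rfl
  have hga : gaF z = List.ofFn fun i => w (e i) := by
    rw [gaF_apply, hw, hws, decNil_encList, hcodes, gatherL_ofFn, List.nil_append, List.map_ofFn]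
    rfl
  have hq : qF z = queryOf e w := by
    simp only [qF, Function.comp_apply, fanoutFn_apply, hark, hga, takeFn_boolPair, length_ones]
    rw [take_ofFn_castSucc]
    rfl
  have htc : tcF z = encodeNat (e (Fin.last k) : ℕ) := by
    simp only [tcF, Function.comp_apply, fanoutFn_apply, hark, hws, dropItemsFn_boolPair, length_ones, sndF_iterate_encList,
      fstF_encList]
    rw [drop_ofFn_last]
    rfl
  have hut : utF z = ones (e (Fin.last k)) := by
    simp only [utF, Function.comp_apply, fanoutFn_apply, hw, htc, binToUnaryFn_label]
  refine ⟨by simp [hE, boolPair], by simp [hg], by simp [e'F, hE], by simp [cT, hco], hco, by simp [hz, Brick.nthF_zero], hw,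
    by simp [hz, nthF], by simp [hz, sndPow], hq, hut, ?_⟩
  rw [wtT_apply, hut, hw, bitAtFn_label]
  simp [headBit]

end OraclePieces

/-! ### One round on a record -/

section RoundSpec

variable (d : List Bool) (l : List (List Bool)) (co : List Bool) (w : QReg N) (φ : ℕ) (vb : Bool) (an : List Bool)
  (ok : Bool) (hh : ℕ) (cd : List Bool) (fl : Bool) (out : List Bool)

/-- The tag bit of a gate-symbol code is `0`. [folklore] -/
theorem headBit_gF_gate (op ar rest ph v : List Bool) (i : Fin N) :
    headBit (gF (rec6 d (encList ((false :: boolPair op (boolPair ar (boolPair (encodeNat i) rest))) :: l)) co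
      (List.ofFn w) ph v)) = false := by
  simp [gF, nthF, encList_cons]

/-- One round on an `H` gate. [cite: AdlemanDeMarraisHuang1997, §6 Lemma 6.10 (proof, step 3)] -/
theorem roundW_rec_H (e : Fin (cliffordT.arity CliffordTOp.H) ↪ Fin N) :
    roundW (rec6 d (encList ((QGate.gate CliffordTOp.H e : QGate cliffordT N).encode :: l)) co
        (List.ofFn w) (ones φ) (tl7 vb an ok hh cd fl out)) =
      rec6 d (encList l) (co.drop 2) (List.ofFn (Function.update w (embH e 0) (headBit co)))
        (ones ((φ + if w (embH e 0) && headBit co then 4 else 0) % 8))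
        (tl7 vb an.tail (ok && !headBit co.tail) (hh + 1) cd.tail (fl || decide (cd = []))
          (if cd = [] ∧ fl = false then [] else out)) := by
  rw [encode_gateH]
  have htag := headBit_gF_gate d l co w [] [true] [] (ones φ) (tl7 vb an ok hh cd fl out) (embH e 0)
  obtain ⟨hE, hop, he', -, hcT, -, -, hui, hwi, hd, hw, hph, -⟩ :=
    pieces_rec6 d l co w (ones φ) (tl7 vb an ok hh cd fl out) [] [true] [] (embH e 0)
  obtain ⟨hco2, haT, -, han', hcd', hvbT, -, hokc, hhh1, hflN, houtN⟩ :=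
    tpieces_rec6 d (encList ((false :: boolPair [] (boolPair [true] (boolPair (encodeNat (embH e 0)) []))) :: l)) co
      (List.ofFn w) (ones φ) vb an ok hh cd fl out
  set z := rec6 d (encList ((false :: boolPair [] (boolPair [true] (boolPair (encodeNat (embH e 0)) []))) :: l))
    co (List.ofFn w) (ones φ) (tl7 vb an ok hh cd fl out) with hz
  have h1 : setF uiF cT z = List.ofFn (Function.update w (embH e 0) (headBit co)) := by
    rw [setF_apply, hui, hcT, hw]
    simpa using set_label w (embH e 0) (headBit co)
  have h2 : iteFn (andFn wiT cT) (addPh 4) (addPh 0) z = ones ((φ + if w (embH e 0) && headBit co then 4 else 0) % 8) := by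
    rw [iteFn_apply (andFn_apply hwi hcT), addPh_apply, addPh_apply, hph, length_ones]
    cases w (embH e 0) <;> cases headBit co <;> simp
  have h3 : andFn okcT (notFn aT) z = [ok && !headBit co.tail] := by rw [andFn_apply hokc (notFn_apply haT)]
  rw [roundW_eq, if_neg hE, htag, if_neg (by simp), if_pos hop, hW, brW, mkW_apply, hd, he', hco2, h1, h2, hvbT, han', h3,
    hhh1, hcd', hflN, houtN]
  rfl

/-- One round on an `S` gate. [cite: AdlemanDeMarraisHuang1997, §6 Lemma 6.10 (proof, step 3)] -/
theorem roundW_rec_S (e : Fin (cliffordT.arity CliffordTOp.S) ↪ Fin N) :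
    roundW (rec6 d (encList ((QGate.gate CliffordTOp.S e : QGate cliffordT N).encode :: l)) co
        (List.ofFn w) (ones φ) (tl7 vb an ok hh cd fl out)) =
      rec6 d (encList l) (co.drop 2) (List.ofFn w) (ones ((φ + if w (embS e 0) then 2 else 0) % 8))
        (tl7 (vb && !headBit co) an.tail (ok && !headBit co.tail) hh cd.tail (fl || decide (cd = []))
          (if cd = [] ∧ fl = false then [] else out)) := by
  rw [encode_gateS]
  have htag := headBit_gF_gate d l co w [true] [true] [] (ones φ) (tl7 vb an ok hh cd fl out) (embS e 0)
  obtain ⟨hE, hop, he', -, -, -, -, -, hwi, hd, hw, hph, -⟩ :=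
    pieces_rec6 d l co w (ones φ) (tl7 vb an ok hh cd fl out) [true] [true] [] (embS e 0)
  obtain ⟨hco2, haT, -, han', hcd', -, hvb'T, hokc, -, hflN, houtN⟩ :=
    tpieces_rec6 d (encList ((false :: boolPair [true] (boolPair [true] (boolPair (encodeNat (embS e 0)) []))) :: l)) co
      (List.ofFn w) (ones φ) vb an ok hh cd fl out
  set z := rec6 d (encList ((false :: boolPair [true] (boolPair [true] (boolPair (encodeNat (embS e 0)) []))) :: l))
    co (List.ofFn w) (ones φ) (tl7 vb an ok hh cd fl out) with hz
  have h2 : iteFn wiT (addPh 2) (addPh 0) z = ones ((φ + if w (embS e 0) then 2 else 0) % 8) := by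
    rw [iteFn_apply hwi, addPh_apply, addPh_apply, hph, length_ones]
    cases w (embS e 0) <;> simp
  have h3 : andFn okcT (notFn aT) z = [ok && !headBit co.tail] := by rw [andFn_apply hokc (notFn_apply haT)]
  have hhh : hhF z = ones hh := by simp [hz, tl7, nthF]
  have hop0 : opF z ≠ [] := by simp [hop]
  rw [roundW_eq, if_neg hE, htag, if_neg (by simp), if_neg hop0, if_pos hop, sW, brW, mkW_apply, hd, he', hco2, hw, h2, hvb'T,
    han', h3, hhh, hcd', hflN, houtN]
  rfl

/-- One round on a `T` gate. [cite: AdlemanDeMarraisHuang1997, §6 Lemma 6.10 (proof, step 3)] -/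
theorem roundW_rec_T (e : Fin (cliffordT.arity CliffordTOp.T) ↪ Fin N) :
    roundW (rec6 d (encList ((QGate.gate CliffordTOp.T e : QGate cliffordT N).encode :: l)) co
        (List.ofFn w) (ones φ) (tl7 vb an ok hh cd fl out)) =
      rec6 d (encList l) (co.drop 2) (List.ofFn w) (ones ((φ + if w (embT e 0) then 1 else 0) % 8))
        (tl7 (vb && !headBit co) an.tail (ok && !headBit co.tail) hh cd.tail (fl || decide (cd = []))
          (if cd = [] ∧ fl = false then [] else out)) := by
  rw [encode_gateT]
  have htag := headBit_gF_gate d l co w [false, true] [true] [] (ones φ) (tl7 vb an ok hh cd fl out) (embT e 0)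
  obtain ⟨hE, hop, he', -, -, -, -, -, hwi, hd, hw, hph, -⟩ :=
    pieces_rec6 d l co w (ones φ) (tl7 vb an ok hh cd fl out) [false, true] [true] [] (embT e 0)
  obtain ⟨hco2, haT, -, han', hcd', -, hvb'T, hokc, -, hflN, houtN⟩ :=
    tpieces_rec6 d (encList ((false :: boolPair [false, true] (boolPair [true] (boolPair (encodeNat (embT e 0)) []))) :: l)) co
      (List.ofFn w) (ones φ) vb an ok hh cd fl out
  set z := rec6 d (encList ((false :: boolPair [false, true] (boolPair [true] (boolPair (encodeNat (embT e 0)) []))) :: l))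
    co (List.ofFn w) (ones φ) (tl7 vb an ok hh cd fl out) with hz
  have h2 : iteFn wiT (addPh 1) (addPh 0) z = ones ((φ + if w (embT e 0) then 1 else 0) % 8) := by
    rw [iteFn_apply hwi, addPh_apply, addPh_apply, hph, length_ones]
    cases w (embT e 0) <;> simp
  have h3 : andFn okcT (notFn aT) z = [ok && !headBit co.tail] := by rw [andFn_apply hokc (notFn_apply haT)]
  have hhh : hhF z = ones hh := by simp [hz, tl7, nthF]
  have hop0 : opF z ≠ [] := by simp [hop]
  have hop1 : opF z ≠ [true] := by simp [hop]
  rw [roundW_eq, if_neg hE, htag, if_neg (by simp), if_neg hop0, if_neg hop1, if_pos hop, tW, brW, mkW_apply, hd, he', hco2, hw,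
    h2, hvb'T, han', h3, hhh, hcd', hflN, houtN]
  rfl

/-- One round on a `CNOT` gate. [cite: AdlemanDeMarraisHuang1997, §6 Lemma 6.10 (proof, step 3)] -/
theorem roundW_rec_CNOT (e : Fin (cliffordT.arity CliffordTOp.CNOT) ↪ Fin N) :
    roundW (rec6 d (encList ((QGate.gate CliffordTOp.CNOT e : QGate cliffordT N).encode :: l)) co
        (List.ofFn w) (ones φ) (tl7 vb an ok hh cd fl out)) =
      rec6 d (encList l) (co.drop 2) (List.ofFn (Function.update w (embC e 1) (w (embC e 1) ^^ w (embC e 0))))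
        (ones (φ % 8))
        (tl7 (vb && !headBit co) an.tail (ok && !headBit co.tail) hh cd.tail (fl || decide (cd = []))
          (if cd = [] ∧ fl = false then [] else out)) := by
  rw [encode_gateCNOT]
  have htag := headBit_gF_gate d l co w [true, true] [true, true] (boolPair (encodeNat (embC e 1)) []) (ones φ)
    (tl7 vb an ok hh cd fl out) (embC e 0)
  obtain ⟨hE, hop, he', -, -, -, hj, -, hwi, hd, hw, hph, -⟩ :=
    pieces_rec6 d l co w (ones φ) (tl7 vb an ok hh cd fl out) [true, true] [true, true] (boolPair (encodeNat (embC e 1)) [])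
      (embC e 0)
  obtain ⟨hco2, haT, -, han', hcd', -, hvb'T, hokc, -, hflN, houtN⟩ :=
    tpieces_rec6 d (encList ((false :: boolPair [true, true] (boolPair [true, true]
      (boolPair (encodeNat (embC e 0)) (boolPair (encodeNat (embC e 1)) [])))) :: l)) co (List.ofFn w) (ones φ) vb an ok hh cd fl out
  set z := rec6 d (encList ((false :: boolPair [true, true] (boolPair [true, true]
    (boolPair (encodeNat (embC e 0)) (boolPair (encodeNat (embC e 1)) [])))) :: l)) co (List.ofFn w)
    (ones φ) (tl7 vb an ok hh cd fl out) with hz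
  have hjv : jF z = encodeNat (embC e 1) := by rw [hj, fstF_boolPair]
  have huj : ujF z = ones (embC e 1) := by
    show binToUnaryFn (fanoutFn wF jF z) = _
    rw [fanoutFn_apply, hw, hjv, binToUnaryFn_label]
  have hwj : wjT z = [w (embC e 1)] := by
    rw [wjT_apply, huj, hw, bitAtFn_label]
    simp [headBit]
  have h1 : setF ujF (xorT wjT wiT) z = List.ofFn (Function.update w (embC e 1) (w (embC e 1) ^^ w (embC e 0))) := by
    rw [setF_apply, huj, xorT_apply hwj hwi, hw]
    simpa using set_label w (embC e 1) (w (embC e 1) ^^ w (embC e 0))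
  have h2 : addPh 0 z = ones (φ % 8) := by rw [addPh_apply, hph, length_ones, Nat.add_zero]
  have h3 : andFn okcT (notFn aT) z = [ok && !headBit co.tail] := by rw [andFn_apply hokc (notFn_apply haT)]
  have hhh : hhF z = ones hh := by simp [hz, tl7, nthF]
  have hop0 : opF z ≠ [] := by simp [hop]
  have hop1 : opF z ≠ [true] := by simp [hop]
  have hop2 : opF z ≠ [false, true] := by simp [hop]
  rw [roundW_eq, if_neg hE, htag, if_neg (by simp), if_neg hop0, if_neg hop1, if_neg hop2, cW, brW, mkW_apply, hd, he', hco2,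
    h1, h2, hvb'T, han', h3, hhh, hcd', hflN, houtN]
  rfl

/-- **One round on an ORACLE gate**: the guessed answer bit (second coin) is XORed into the
answer wire, the guess is compared with the supplied answer bit, and the query `queryOf e w` is
written into the output in the writing round. [cite: BennettBernsteinBrassardVazirani1997, §3] [cite: FortnowRogers1999JCSS, §3] -/
theorem roundW_rec_oracle {k : ℕ} (e : Fin (k + 1) ↪ Fin N) :
    roundW (rec6 d (encList ((QGate.oracle k e : QGate cliffordT N).encode :: l)) co
        (List.ofFn w) (ones φ) (tl7 vb an ok hh cd fl out)) =
      rec6 d (encList l) (co.drop 2)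
        (List.ofFn (Function.update w (e (Fin.last k)) (w (e (Fin.last k)) ^^ headBit co.tail))) (ones (φ % 8))
        (tl7 (vb && !headBit co) an.tail (ok && (headBit co.tail == headBit an)) hh cd.tail (fl || decide (cd = []))
          (if cd = [] ∧ fl = false then queryOf e w else out)) := by
  obtain ⟨hE, htag, he', hcT, -, hd, hw, hph, -, hq, hut, hwt⟩ := opieces_rec6 d l co w (ones φ) (tl7 vb an ok hh cd fl out) e
  obtain ⟨hco2, haT, hanT, han', hcd', -, hvb'T, hokc, -, hflN, houtN⟩ :=
    tpieces_rec6 d (encList ((QGate.oracle k e : QGate cliffordT N).encode :: l)) co (List.ofFn w) (ones φ) vb an ok hh cd fl out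
  set z := rec6 d (encList ((QGate.oracle k e : QGate cliffordT N).encode :: l)) co (List.ofFn w) (ones φ)
    (tl7 vb an ok hh cd fl out) with hz
  have h1 : setF utF (xorT wtT aT) z = List.ofFn (Function.update w (e (Fin.last k)) (w (e (Fin.last k)) ^^ headBit co.tail)) := by
    rw [setF_apply, hut, xorT_apply hwt haT, hw]
    simpa using set_label w (e (Fin.last k)) (w (e (Fin.last k)) ^^ headBit co.tail)
  have h2 : addPh 0 z = ones (φ % 8) := by rw [addPh_apply, hph, length_ones, Nat.add_zero]
  have h3 : andFn okcT (eqvT aT anT) z = [ok && (headBit co.tail == headBit an)] := by rw [andFn_apply hokc (eqvT_apply haT hanT)]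
  have hhh : hhF z = ones hh := by simp [hz, tl7, nthF]
  rw [roundW_eq, if_neg hE, if_pos htag, oW, brW, mkW_apply, hd, he', hco2, h1, h2, hvb'T, han', h3, hhh, hcd', hflN, houtN, hq]
  rfl

/-- **One round is one machine step.** On the record of a machine state whose next gate is `g`
(any placed gate, oracle gates included), `roundW` splits the gate off, reads two coins, and
performs `mStep g` on the choice bit and the guessed answer bit.
[cite: AdlemanDeMarraisHuang1997, §6 Lemma 6.10 (proof, step 3)] [cite: FortnowRogers1999JCSS, §3 ("Theorem 3.1 relativizes")] -/
theorem roundW_recOf (g : QGate cliffordT N) (m : MS N) :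
    roundW (recOf d (encList (g.encode :: l)) co m) = recOf d (encList l) (co.drop 2) (mStep g (headBit co) (headBit co.tail) m) := by
  obtain ⟨⟨w, φ, vb⟩, an, ok, hh, cd, fl, out⟩ := m
  rw [recOf_eq, recOf_eq]
  cases g with
  | oracle k e =>
    rw [roundW_rec_oracle]
    simp only [mStep, gStep, isOr, gQry, Bool.true_and]
    rfl
  | gate op e =>
    cases op with
    | H =>
      rw [roundW_rec_H]
      simp only [mStep, gStep, tStep, isOr, gQry, Bool.false_and, QGateIsH]
      cases headBit co.tail <;> rfl
    | S =>
      rw [roundW_rec_S]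
      simp only [mStep, gStep, tStep, isOr, gQry, Bool.false_and, QGateIsH]
      cases headBit co.tail <;> rfl
    | T =>
      rw [roundW_rec_T]
      simp only [mStep, gStep, tStep, isOr, gQry, Bool.false_and, QGateIsH]
      cases headBit co.tail <;> rfl
    | CNOT =>
      rw [roundW_rec_CNOT]
      simp only [mStep, gStep, tStep, isOr, gQry, Bool.false_and, QGateIsH]
      cases headBit co.tail <;> rfl

end RoundSpec

/-! ### The walk on a record -/

/-- A record with no gate ahead is fixed by the round. [folklore] -/
theorem roundW_idle (d co : List Bool) (m : MS N) : roundW (recOf d [] co m) = recOf d [] co m := by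
  obtain ⟨hd, hE, hco, hw, hph, hvb, han, hok, hhh, hcd, hfl, hout⟩ := fields_recOf d [] co m
  rw [roundW_eq, if_pos hE, idleW, mkW_apply, hd, hE, hco, hw, hph, hvb, han, hok, hhh, hcd, hfl, hout]
  rfl

/-- **Enough rounds walk the whole gate list** (`mRun`), consuming two coins per gate, and then
idle. [cite: AdlemanDeMarraisHuang1997, §6 Lemma 6.10 (proof, step 3)] -/
theorem iterate_roundW (d : List Bool) (gs : List (QGate cliffordT N)) :
    ∀ (n : ℕ) (co : List Bool) (m : MS N), gs.length ≤ n →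
    roundW^[n] (recOf d (encList (gs.map QGate.encode)) co m) = recOf d [] (co.drop (2 * gs.length)) (mRun gs co m) := by
  induction gs with
  | nil =>
    intro n co m _
    simp only [List.map_nil, encList_nil, List.length_nil, Nat.mul_zero, List.drop_zero, mRun]
    exact Function.iterate_fixed (roundW_idle d co m) n
  | cons g gs ih =>
    intro n co m hn
    rw [List.length_cons] at hn
    obtain ⟨n, rfl⟩ : ∃ n', n = n' + 1 := Nat.exists_eq_add_one.2 (by omega)
    rw [Function.iterate_succ_apply, List.map_cons, roundW_recOf d (gs.map QGate.encode) co g m,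
      ih n (co.drop 2) _ (by omega)]
    simp only [mRun, List.drop_drop, List.length_cons]
    congr 2
    ring

/-- The walk on the record of a machine state: `passW` runs `|d|` rounds. [folklore] -/
theorem passW_recOf (d E co : List Bool) (m : MS N) : passW (recOf d E co m) = roundW^[d.length] (recOf d E co m) :=
  passW_rec6 _ _ _ _ _ _

end ADH

end Literature.Computability.QuantumComplexity

end
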